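import Summits.QuantumFields.BalabanUV.Beta.D1BFx.TorusCoframeJets
import Summits.QuantumFields.BalabanUV.Beta.D1BFx.GramWeightJetsMixed

/-!
# `BalabanUV.Beta.D1BFx.TorusWeightJetsCombFree` — road «BF-x» for binder row D1, slot (K), X₃(ii) ROUTE T, owner row **«TB4-W»** (K-ASSEMBLY-SPEC v2.5 §3 (T3),
# rulings ρ-g6-12 (1) ∕ ρ-g6-13 (1)), PART 3a — **THE WEIGHT JETS ARE COMB-FREE**: on every fine torus the Gram-form weight jets
# `B₀ = gram₀ T₀ A₀`, `Bₛ = gram₁ T₀ Tₛ A₀ Aₛ`, `Bₛₜ = gramMix T₀ Tₛ Tₜ Tₛₜ A₀ Aₛ Aₜ Aₛₜ` of K-TA4G (R2) at PART 2's co-frame ∕ inverse jets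
# (`TorusCoframeJets.Tjet•`, `Ajet•` over a basis matrix `N`) are `2•(M̂•ᵀ Ĉ• M̂•)`-polynomials in the SITE matrices `Ĉ := N·(NᵀL̂L̂N)⁻¹·Nᵀ` and its jets
# `Ĉₛ = −Ĉ(L̂²)ₛĈ`, `Ĉₛₜ`, re-indexed by `e` — the comb index `ρ` is ELIMINATED; and for a basis `N` of `ker Ŝ`, **`Ĉ = (m+1)⁴•Ĝ′(1 − P̂)Ĝ′`**
# (`PeriodisedProjector.Ghat`∕`Phat`: periodised DECAYING block-periodic `ℤ⁴` kernels), so every weight-jet monomial is «periodic decaying legs × ONE local jet»,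
# and `B₀` re-indexed by `e₁` is `2•X̂(0) − K̂` (`TorusHodgeWeight`) again

HONEST DEPENDENCY (cell records, verbatim): «continuum YM on T⁴ ⇐ BetaPertH ∧ nine spine estimates (0/9 proved); BetaPertH ⇐ (D1) ∧ (D4) ∧
CAP+tail; G-an2-4 gates asym, D1 and NE2/3/4.»  HONEST FRAMING (cell contract, verbatim): «discharging `BetaPertH` makes Bałaban's UV stability
UNCONDITIONAL — a real constructive-QFT result; it is NOT the continuum limit and NOT the Clay problem.»  THIS MODULE DISCHARGES NOTHING of (K),
of D1 or of the wall: [our object] data definitions (explicit finite matrices, asserting nothing) and [folklore] finite matrix algebra over PART 2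
`TorusCoframeJets` (p243088), gan24-leaf-03-g44's `GramWeightJets.gram₀∕gram₁` ∕ `GramWeightJetsMixed.gramMix`, the owner's `TorusGaugeWeight.Rhat_eq_gramProj`
(`1 − P̂ = L̂N(NᵀL̂L̂N)⁻¹NᵀL̂`) ∕ `PeriodisedProjector.Ghat_Lhat_mulVec` (`Ĝ′L̂λ = (m+1)⁻²λ` on `ker Ŝ`) ∕ `Ghat_transpose`, and gan24-leaf-06-g31's
`TorusHodgeWeight.two_smul_Xhat_zero_sub_Khat`, all BY NAME.  THE SIGN DICTIONARY of PART 1b applies (`ε = +1` here; `Bₛ` is odd, `B₀`∕`Bₛₜ` even in `ε`).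
No `def … : Prop`, nothing cited, no wall binder instantiated, 0 sorry.  0∕4 binders of row D1; (K) NOT closed; NOT D1, NOT BetaPertH, NOT continuum, NOT Clay.

ABSOLUTE RULE (cell charter, verbatim): «No internally-minted statement may enter as a cited fact. Every hypothesis is either kernel-proved in this
package or a verbatim quotation of a PUBLISHED theorem with page reference. The manuscript(s) under audit are NOT citable for their own disputed
steps — they are the thing under adjudication; programme-internal (2001/route/tribunal) claims are never citable.»

CONTENT (fine torus `Site 4 s`, `L̂ := Lhat s`, PART 2's `Ljet`∕`Ljet₁₁`∕`Mjet•`∕`Tjet•`∕`Gjet•`∕`Ajet•`; `N : Matrix (Site 4 s) ρ ℝ`, `e : ν → Site 4 s × Fin 4`):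
* §1 [our object] the squared-Laplacian jets `Lsq₀ = L̂L̂`, `Lsq₁ b = Ljet·L̂ + L̂·Ljet`, `Lsq₁₁ b b′`; `Gjet• = Nᵀ·Lsq•·N`.
* §2 [our object] `Chat s N := N·(Gjet₀ s N)⁻¹·Nᵀ`, `Cjet₁`, `Cjet₁₁` (the inverse-jet polynomials); **`N·Ajet₀·Nᵀ = 2•Ĉ`**, **`N·Ajet₁·Nᵀ = 2•Ĉₛ`**, **`N·Ajet₁₁·Nᵀ = 2•Ĉₛₜ`**.
* §3 [our object] the COMB-FREE WEIGHT JETS `wgt₀ := M̂₀ᵀĈM̂₀`, `wgt₁ b := M̂ₛᵀĈM̂₀ + M̂₀ᵀĈₛM̂₀ + M̂₀ᵀĈM̂ₛ`, `wgtMix b b′` (nine terms); [folklore] `sandwich_submatrix` and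
  **`gram₀_Tjet : gram₀ (Tjet₀ s N e) (Ajet₀ s N) = (2•wgt₀ s N).submatrix e e`**, **`gram₁_Tjet`**, **`gramMix_Tjet`** — pure matrix algebra, any `N`, any `e`.
* §4 for a basis `N` of `ker Ŝ` (`hN`, `hNinj`, `0 < a`, `s = (m+1)p`): `Ghat_Lhat_mul_basis : Ĝ′L̂N = (m+1)⁻²•N`, **`Chat_eq : Ĉ = (m+1)⁴•Ĝ′(1 − P̂)Ĝ′`**,
  `Lhat_Chat_Lhat : L̂ĈL̂ = 1 − P̂`, `wgt₀_eq : wgt₀ = D̂(1 − P̂)D̂ᵀ`, and the closure **`gram₀_Tjet_road : gram₀ (Tjet₀ (e₁ (m+1) p)) Ajet₀ = 2•X̂(0) − K̂`**.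
NOT HERE: the `ℤ⁴` arrays of the local jets (PART 3b), TB4-tables (T1), (T2-kin), TB5.
Provenance: D1 formalisation swarm, unit `b2b-balaban-beta-d1-formalise-leaf-03` (gen 9), claim «TB4-W» journal l.23490 ∕ plan l.24110, 2026-08-21.
-/

noncomputable section

namespace Summit.QuantumFields.BalabanUV.Beta.D1BFx.TorusWeightJetsCombFree

open Matrix
open scoped BigOperators
open Literature.MathematicalPhysics.QuantumFieldTheory.Balaban1983to89
open Literature.MathematicalPhysics.QuantumFieldTheory.Balaban1983to89.Beta
open Summit.QuantumFields.BalabanUV.Beta.D1BFx.PeriodisedProjector (Lhat Shat Phat Ghat Ghat_Lhat_mulVec Ghat_transpose)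
open Summit.QuantumFields.BalabanUV.Beta.D1BFx.TorusGaugeWeight (Lhat_transpose Rhat_eq_gramProj isUnit_det_gram)
open Summit.QuantumFields.BalabanUV.Beta.D1BFx.TorusHodgeWeight (Dhat DhatS two_smul_Xhat_zero_sub_Khat RGhat_eq_DhatS RGhat_eq_submatrix)
open Summit.QuantumFields.BalabanUV.Beta.D1BFx.SortedEmbedding (e₁)
open Summit.QuantumFields.BalabanUV.Beta.D1BFx.TorusCombKKT (Khat)
open Summit.QuantumFields.BalabanUV.Beta.D1BFx.TorusBorderedResolvent (Xhat)
open Summit.QuantumFields.BalabanUV.Beta.D1BFx.GramWeightJets (gram₀ gram₁)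
open Summit.QuantumFields.BalabanUV.Beta.D1BFx.GramWeightJetsMixed (gramMix)
open Summit.QuantumFields.BalabanUV.Beta.D1BFx.TorusCoframeJets (Djet Ljet Ljet₁₁ Mjet₀ Mjet₁ Mjet₁₁ Tjet₀ Tjet₁ Tjet₁₁ Gjet₀ Gjet₁ Gjet₁₁ Ajet₀ Ajet₁ Ajet₁₁
  submatrix_id_mul Tjet₀_eq_coframe)

variable (s : ℕ) [NeZero s] (b b' : Site 4 s × Fin 4)

/-! ## §1 The squared-Laplacian jets; `Gjet• = Nᵀ·Lsq•·N` -/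

/-- [our object] `(L̂²)₀ = L̂·L̂`. -/
def Lsq₀ : Matrix (Site 4 s) (Site 4 s) ℝ := Lhat s * Lhat s

/-- [our object] `(L̂²)ₛ = Ljet·L̂ + L̂·Ljet`. -/
def Lsq₁ : Matrix (Site 4 s) (Site 4 s) ℝ := Ljet s b * Lhat s + Lhat s * Ljet s b

/-- [our object] `(L̂²)ₛₜ = Ljet₁₁·L̂ + Ljet b·Ljet b′ + Ljet b′·Ljet b + L̂·Ljet₁₁`. -/
def Lsq₁₁ : Matrix (Site 4 s) (Site 4 s) ℝ := Ljet₁₁ s b b' * Lhat s + Ljet s b * Ljet s b' + Ljet s b' * Ljet s b + Lhat s * Ljet₁₁ s b b'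

section Basis

variable {ρ ν : Type*} [Fintype ρ] [DecidableEq ρ] (N : Matrix (Site 4 s) ρ ℝ) (e : ν → Site 4 s × Fin 4)

omit [Fintype ρ] [DecidableEq ρ] in
/-- [folklore] `G₀ = Nᵀ·(L̂²)₀·N`. -/
theorem Gjet₀_eq : Gjet₀ s N = Nᵀ * Lsq₀ s * N := by
  rw [Gjet₀, Lsq₀, Matrix.mul_assoc Nᵀ]

omit [Fintype ρ] [DecidableEq ρ] in
/-- [folklore] `Gₛ = Nᵀ·(L̂²)ₛ·N` (`rfl`). -/
theorem Gjet₁_eq : Gjet₁ s b N = Nᵀ * Lsq₁ s b * N := rfl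

omit [Fintype ρ] [DecidableEq ρ] in
/-- [folklore] `Gₛₜ = Nᵀ·(L̂²)ₛₜ·N` (`rfl`). -/
theorem Gjet₁₁_eq : Gjet₁₁ s b b' N = Nᵀ * Lsq₁₁ s b b' * N := rfl

/-! ## §2 `Ĉ = N·G₀⁻¹·Nᵀ` and its jets; `N·A•·Nᵀ = 2•Ĉ•` -/

/-- [our object] **`Ĉ := N·(NᵀL̂L̂N)⁻¹·Nᵀ`** (site × site; for a basis of `ker Ŝ` the `L̂²`-Green's function on block-mean-free functions, §4).  A definition. -/
def Chat : Matrix (Site 4 s) (Site 4 s) ℝ := N * (Gjet₀ s N)⁻¹ * Nᵀ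

/-- [our object] **`Ĉₛ := −Ĉ·(L̂²)ₛ·Ĉ`** (first inverse jet).  A definition. -/
def Cjet₁ : Matrix (Site 4 s) (Site 4 s) ℝ := -(Chat s N * Lsq₁ s b * Chat s N)

/-- [our object] **`Ĉₛₜ := −Ĉ(L̂²)ₛₜĈ + Ĉ(L̂²)ₛĈ(L̂²)ₜĈ + Ĉ(L̂²)ₜĈ(L̂²)ₛĈ`** (mixed inverse jet).  A definition. -/
def Cjet₁₁ : Matrix (Site 4 s) (Site 4 s) ℝ :=
  -(Chat s N * Lsq₁₁ s b b' * Chat s N) + Chat s N * Lsq₁ s b * Chat s N * Lsq₁ s b' * Chat s N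
    + Chat s N * Lsq₁ s b' * Chat s N * Lsq₁ s b * Chat s N

/-- [folklore] **`N·A₀·Nᵀ = 2•Ĉ`.** -/
theorem basis_mul_Ajet₀ : N * Ajet₀ s N * Nᵀ = (2 : ℝ) • Chat s N := by
  rw [Ajet₀, Chat, Matrix.mul_smul, Matrix.smul_mul]

/-- [folklore] **`N·Aₛ·Nᵀ = 2•Ĉₛ`.** -/
theorem basis_mul_Ajet₁ : N * Ajet₁ s b N * Nᵀ = (2 : ℝ) • Cjet₁ s b N := by
  rw [Ajet₁, Cjet₁, Chat, Gjet₁_eq, Matrix.mul_neg, Matrix.neg_mul, Matrix.mul_smul, Matrix.smul_mul, smul_neg]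
  simp only [Matrix.mul_assoc]

/-- [folklore] **`N·Aₛₜ·Nᵀ = 2•Ĉₛₜ`.** -/
theorem basis_mul_Ajet₁₁ : N * Ajet₁₁ s b b' N * Nᵀ = (2 : ℝ) • Cjet₁₁ s b b' N := by
  rw [Ajet₁₁, Cjet₁₁, Chat, Gjet₁_eq, Gjet₁_eq, Gjet₁₁_eq, Matrix.mul_smul, Matrix.smul_mul, Matrix.mul_add, Matrix.mul_add, Matrix.add_mul,
    Matrix.add_mul, Matrix.mul_neg, Matrix.neg_mul]
  simp only [Matrix.mul_assoc]

/-! ## §3 The comb-free weight jets and the Gram identities -/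

/-- [our object] **`wgt₀ := M̂₀ᵀ·Ĉ·M̂₀`** (half the zeroth weight).  A definition. -/
def wgt₀ : Matrix (Site 4 s × Fin 4) (Site 4 s × Fin 4) ℝ := (Mjet₀ s)ᵀ * Chat s N * Mjet₀ s

/-- [our object] **`wgt₁ b := M̂ₛᵀĈM̂₀ + M̂₀ᵀĈₛM̂₀ + M̂₀ᵀĈM̂ₛ`** (half the first weight jet).  A definition. -/
def wgt₁ : Matrix (Site 4 s × Fin 4) (Site 4 s × Fin 4) ℝ :=
  (Mjet₁ s b)ᵀ * Chat s N * Mjet₀ s + (Mjet₀ s)ᵀ * Cjet₁ s b N * Mjet₀ s + (Mjet₀ s)ᵀ * Chat s N * Mjet₁ s b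

/-- [our object] **`wgtMix b b′`** := the nine-term mixed jet of `M̂ᵀĈM̂` (half the mixed weight jet).  A definition. -/
def wgtMix : Matrix (Site 4 s × Fin 4) (Site 4 s × Fin 4) ℝ :=
  (Mjet₁₁ s b b')ᵀ * Chat s N * Mjet₀ s + (Mjet₁ s b)ᵀ * Cjet₁ s b' N * Mjet₀ s + (Mjet₁ s b')ᵀ * Cjet₁ s b N * Mjet₀ s
    + (Mjet₀ s)ᵀ * Cjet₁₁ s b b' N * Mjet₀ s + (Mjet₁ s b)ᵀ * Chat s N * Mjet₁ s b' + (Mjet₁ s b')ᵀ * Chat s N * Mjet₁ s b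
    + (Mjet₀ s)ᵀ * Cjet₁ s b N * Mjet₁ s b' + (Mjet₀ s)ᵀ * Cjet₁ s b' N * Mjet₁ s b + (Mjet₀ s)ᵀ * Chat s N * Mjet₁₁ s b b'

omit [DecidableEq ρ] in
/-- [folklore] **THE SANDWICH RULE**: `((NᵀX)|ₑ)ᵀ·B·((NᵀY)|ₑ) = (Xᵀ·(N·B·Nᵀ)·Y).submatrix e e` (column re-indexing `|ₑ := submatrix id e`). -/
theorem sandwich_submatrix {β β' : Type*} [Fintype β] [Fintype β'] (X : Matrix (Site 4 s) β ℝ) (Y : Matrix (Site 4 s) β' ℝ) (B : Matrix ρ ρ ℝ)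
    (f : ν → β) (g : ν → β') :
    ((Nᵀ * X).submatrix id f)ᵀ * B * (Nᵀ * Y).submatrix id g = (Xᵀ * (N * B * Nᵀ) * Y).submatrix f g := by
  rw [Matrix.transpose_submatrix, Matrix.transpose_mul, Matrix.transpose_transpose,
    Matrix.submatrix_mul _ _ f id id Function.bijective_id, Matrix.submatrix_id_id,
    Matrix.submatrix_mul _ _ f id g Function.bijective_id, Matrix.submatrix_mul _ _ f id id Function.bijective_id, Matrix.submatrix_id_id,
    submatrix_id_mul]
  simp only [Matrix.mul_assoc]

/-- [folklore] **`B₀` COMB-FREE**: `gram₀ T₀ A₀ = (2•M̂₀ᵀĈM̂₀).submatrix e e`. -/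
theorem gram₀_Tjet : gram₀ (Tjet₀ s N e) (Ajet₀ s N) = ((2 : ℝ) • wgt₀ s N).submatrix e e := by
  rw [gram₀, Tjet₀, sandwich_submatrix, basis_mul_Ajet₀, wgt₀, Matrix.mul_smul, Matrix.smul_mul]

/-- [folklore] **`Bₛ` COMB-FREE**: `gram₁ T₀ Tₛ A₀ Aₛ = (2•(M̂ₛᵀĈM̂₀ + M̂₀ᵀĈₛM̂₀ + M̂₀ᵀĈM̂ₛ)).submatrix e e`. -/
theorem gram₁_Tjet : gram₁ (Tjet₀ s N e) (Tjet₁ s b N e) (Ajet₀ s N) (Ajet₁ s b N) = ((2 : ℝ) • wgt₁ s b N).submatrix e e := by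
  rw [gram₁, Matrix.add_mul, Tjet₀, Tjet₁, sandwich_submatrix, sandwich_submatrix, sandwich_submatrix, basis_mul_Ajet₀, basis_mul_Ajet₁, wgt₁,
    smul_add, smul_add, Matrix.submatrix_add, Matrix.submatrix_add, Pi.add_apply, Pi.add_apply, Pi.add_apply, Pi.add_apply]
  simp only [Matrix.mul_smul, Matrix.smul_mul]

/-- [folklore] **`Bₛₜ` COMB-FREE**: `gramMix T₀ Tₛ Tₜ Tₛₜ A₀ Aₛ Aₜ Aₛₜ = (2•wgtMix).submatrix e e`. -/
theorem gramMix_Tjet : gramMix (Tjet₀ s N e) (Tjet₁ s b N e) (Tjet₁ s b' N e) (Tjet₁₁ s b b' N e)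
      (Ajet₀ s N) (Ajet₁ s b N) (Ajet₁ s b' N) (Ajet₁₁ s b b' N) = ((2 : ℝ) • wgtMix s b b' N).submatrix e e := by
  rw [gramMix, Tjet₀, Tjet₁, Tjet₁, Tjet₁₁]
  simp only [sandwich_submatrix, basis_mul_Ajet₀, basis_mul_Ajet₁, basis_mul_Ajet₁₁]
  rw [wgtMix]
  simp only [smul_add, Matrix.submatrix_add, Pi.add_apply, Matrix.mul_smul, Matrix.smul_mul]

end Basis

/-! ## §4 For a basis of `ker Ŝ`: `Ĉ = (m+1)⁴•Ĝ′(1 − P̂)Ĝ′`, `L̂ĈL̂ = 1 − P̂`, and `B₀` re-indexed by `e₁` is `2•X̂(0) − K̂` -/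

section KerS

variable (m : ℕ) {a : ℝ} (p : ℕ) [NeZero p] {ρ : Type*} [Fintype ρ] [DecidableEq ρ]

omit [Fintype ρ] [DecidableEq ρ] in
/-- [folklore] Columns through `mulVec`: `(A·N) i j = (A *ᵥ N.col j) i`. -/
theorem mul_apply_eq_mulVec_col {α : Type*} (A : Matrix α (Site 4 ((m + 1) * p)) ℝ) (N : Matrix (Site 4 ((m + 1) * p)) ρ ℝ) (i : α) (j : ρ) :
    (A * N) i j = (A *ᵥ N.col j) i := rfl

omit [Fintype ρ] [DecidableEq ρ] in
/-- [folklore] **`Ĝ′·L̂·N = (m+1)⁻²•N`** for a basis `N` of `ker Ŝ` (`PeriodisedProjector.Ghat_Lhat_mulVec` column by column). -/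
theorem Ghat_Lhat_mul_basis (ha : 0 < a) {N : Matrix (Site 4 ((m + 1) * p)) ρ ℝ} [Fintype ρ] [DecidableEq ρ]
    (hN : ∀ lam : Site 4 ((m + 1) * p) → ℝ, Shat m ((m + 1) * p) *ᵥ lam = 0 ↔ ∃ c : ρ → ℝ, lam = N *ᵥ c) :
    Ghat m a ((m + 1) * p) * Lhat ((m + 1) * p) * N = (((m : ℝ) + 1) ^ 2)⁻¹ • N := by
  ext i j
  have hcol : Shat m ((m + 1) * p) *ᵥ N.col j = 0 := (hN _).2 ⟨Pi.single j 1, (Matrix.mulVec_single_one N j).symm⟩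
  rw [mul_apply_eq_mulVec_col, ← Matrix.mulVec_mulVec, Ghat_Lhat_mulVec ha rfl hcol, Matrix.smul_apply, Pi.smul_apply]
  rfl

/-- [folklore] **`Ĉ = (m+1)⁴•Ĝ′·(1 − P̂)·Ĝ′`** for a basis `N` of `ker Ŝ`: the comb-free centre of the weight jets is a periodised product of the DECAYING
block-periodic kernels `G′` and `δ − Pker` (`Rhat_eq_gramProj`, `Ghat_Lhat_mul_basis`, `Ghat_transpose`, `Lhat_transpose`). -/
theorem Chat_eq (ha : 0 < a) {N : Matrix (Site 4 ((m + 1) * p)) ρ ℝ}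
    (hN : ∀ lam : Site 4 ((m + 1) * p) → ℝ, Shat m ((m + 1) * p) *ᵥ lam = 0 ↔ ∃ c : ρ → ℝ, lam = N *ᵥ c)
    (hNinj : Function.Injective N.mulVec) :
    Chat ((m + 1) * p) N = (((m : ℝ) + 1) ^ 4) • (Ghat m a ((m + 1) * p) * (1 - Phat m a ((m + 1) * p)) * Ghat m a ((m + 1) * p)) := by
  have hGL := Ghat_Lhat_mul_basis m p ha hN
  have hLG : Nᵀ * Lhat ((m + 1) * p) * Ghat m a ((m + 1) * p) = (((m : ℝ) + 1) ^ 2)⁻¹ • Nᵀ := by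
    have h := congrArg Matrix.transpose hGL
    rw [Matrix.transpose_mul, Matrix.transpose_mul, Ghat_transpose ha rfl, Lhat_transpose, Matrix.transpose_smul, ← Matrix.mul_assoc] at h
    exact h
  rw [Rhat_eq_gramProj ha rfl hN hNinj]
  have e : Ghat m a ((m + 1) * p) * (Lhat ((m + 1) * p) * N * (Nᵀ * Lhat ((m + 1) * p) * Lhat ((m + 1) * p) * N)⁻¹ * Nᵀ * Lhat ((m + 1) * p))
        * Ghat m a ((m + 1) * p)
      = (Ghat m a ((m + 1) * p) * Lhat ((m + 1) * p) * N) * (Gjet₀ ((m + 1) * p) N)⁻¹ * (Nᵀ * Lhat ((m + 1) * p) * Ghat m a ((m + 1) * p)) := by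
    rw [Gjet₀]; simp only [Matrix.mul_assoc]
  rw [e, hGL, hLG, Matrix.smul_mul, Matrix.smul_mul, Matrix.mul_smul, smul_smul, smul_smul, Chat]
  have hm : ((m : ℝ) + 1) ≠ 0 := by positivity
  rw [show ((m : ℝ) + 1) ^ 4 * (((m : ℝ) + 1) ^ 2)⁻¹ * (((m : ℝ) + 1) ^ 2)⁻¹ = 1 by field_simp, one_smul]

omit [DecidableEq ρ] in
/-- [folklore] **`L̂·Ĉ·L̂ = 1 − P̂`** for a basis `N` of `ker Ŝ` (`Rhat_eq_gramProj` re-read). -/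
theorem Lhat_Chat_Lhat (ha : 0 < a) {N : Matrix (Site 4 ((m + 1) * p)) ρ ℝ} [DecidableEq ρ]
    (hN : ∀ lam : Site 4 ((m + 1) * p) → ℝ, Shat m ((m + 1) * p) *ᵥ lam = 0 ↔ ∃ c : ρ → ℝ, lam = N *ᵥ c)
    (hNinj : Function.Injective N.mulVec) :
    Lhat ((m + 1) * p) * Chat ((m + 1) * p) N * Lhat ((m + 1) * p) = 1 - Phat m a ((m + 1) * p) := by
  rw [Rhat_eq_gramProj ha rfl hN hNinj, Chat, Gjet₀]
  simp only [Matrix.mul_assoc]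

/-- [folklore] **`wgt₀ = D̂·(1 − P̂)·D̂ᵀ`** for a basis `N` of `ker Ŝ` — the comb-free zeroth weight is gan24-leaf-06-g31's Hodge sandwich. -/
theorem wgt₀_eq (ha : 0 < a) {N : Matrix (Site 4 ((m + 1) * p)) ρ ℝ}
    (hN : ∀ lam : Site 4 ((m + 1) * p) → ℝ, Shat m ((m + 1) * p) *ᵥ lam = 0 ↔ ∃ c : ρ → ℝ, lam = N *ᵥ c)
    (hNinj : Function.Injective N.mulVec) :
    wgt₀ ((m + 1) * p) N = Dhat 4 ((m + 1) * p) * (1 - Phat m a ((m + 1) * p)) * (Dhat 4 ((m + 1) * p))ᵀ := by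
  rw [wgt₀, Mjet₀, ← Lhat_Chat_Lhat m p ha hN hNinj, Matrix.transpose_mul, Matrix.transpose_transpose, Lhat_transpose]
  simp only [Matrix.mul_assoc]

/-- [folklore] **CLOSURE WITH TB5-0**: for a basis `N` of `ker Ŝ`, the comb-free `B₀` re-indexed by `e₁` IS the weight `2•X̂(0) − K̂` of the N-side of the
slice-transfer identity (`TorusHodgeWeight.two_smul_Xhat_zero_sub_Khat`). -/
theorem gram₀_Tjet_road (ha : 0 < a) {N : Matrix (Site 4 ((m + 1) * p)) ρ ℝ}
    (hN : ∀ lam : Site 4 ((m + 1) * p) → ℝ, Shat m ((m + 1) * p) *ᵥ lam = 0 ↔ ∃ c : ρ → ℝ, lam = N *ᵥ c)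
    (hNinj : Function.Injective N.mulVec) :
    gram₀ (Tjet₀ ((m + 1) * p) N (e₁ (m + 1) p)) (Ajet₀ ((m + 1) * p) N) = (2 : ℝ) • Xhat m a p 0 - Khat (d := 3) (m + 1) p := by
  rw [gram₀_Tjet, wgt₀_eq m p ha hN hNinj, two_smul_Xhat_zero_sub_Khat m p ha, ← RGhat_eq_DhatS m p ha, RGhat_eq_submatrix m p ha]
  ext i j
  rfl

end KerS

end Summit.QuantumFields.BalabanUV.Beta.D1BFx.TorusWeightJetsCombFree

end
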